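import Mathlib

/-!
# `GradedDesignFamily` (crux `stmt-MatrixMultiplication-7610`, route `LevelGradedCohnUmans`),
# line `quadratic-extension-level-one-cell`, negative side — the abstract COMPONENT LEMMA

Linear-algebra core of the component lemma of the line's negative programme (c6 dossier §7).
A separator of the shadow design decomposes into isotype coefficient functions `f η ∈ F η ≤ ℂ^B`
(one per character `η ∈ E` of the grid group, each `F η` of dimension `≤ m`), and coherent
garbage forces the pointwise isotype vector `(f η b)_η` to lie in a FIXED subspace `D ≤ ℂ^E` at
every base point `b`.  Conclusion (`finrank_le_of_pointwise_mem`): a subspace `W ≤ ℂ^(E × B)` of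
such tuples has `dim W ≤ dim D · m`.

Proof: induction on `dim D`.  If `D = ⊥` every column of every `f ∈ W` vanishes, so `W = ⊥`.
Otherwise pick `v ∈ D` and a coordinate `η₀` with `v η₀ ≠ 0`; the row map `ρ : W → ℂ^B`,
`f ↦ f η₀`, has range inside `F η₀` (dimension `≤ m`) and its kernel consists of tuples whose
columns lie in `D' = D ⊓ ker (eval η₀)`, a subspace of dimension `≤ dim D − 1` (it misses `v`);
rank–nullity and the induction hypothesis give `dim W ≤ m + (dim D − 1) · m`.
-/

set_option linter.dupNamespace false

noncomputable section

open Module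

namespace Summit.MatrixMultiplication.MatrixMultiplication.Theorems.GradedDesignFamily.Negative

/-- Inductive form of the component lemma: if `dim D ≤ n`, every row `f η` of every `f ∈ W`
lies in `F η` (`dim F η ≤ m`) and every column `(f η b)_η` lies in `D`, then `dim W ≤ n · m`.
Induction on `n`, splitting off one row `η₀` on which `D` has a non-vanishing coordinate. -/
theorem finrank_le_mul_of_pointwise_mem_aux {E B : Type} [Fintype E] [Fintype B]
    (F : E → Submodule ℂ (B → ℂ)) (m : ℕ) (hF : ∀ η, Module.finrank ℂ (F η) ≤ m) (n : ℕ) :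
    ∀ (D : Submodule ℂ (E → ℂ)), Module.finrank ℂ D ≤ n → ∀ (W : Submodule ℂ (E → B → ℂ)),
      (∀ f ∈ W, ∀ η, f η ∈ F η) → (∀ f ∈ W, ∀ b, (fun η => f η b) ∈ D) →
      Module.finrank ℂ W ≤ n * m := by
  induction n with
  | zero =>
    intro D hD W _hW₁ hW₂
    have hD0 : D = ⊥ := Submodule.finrank_eq_zero.mp (Nat.le_zero.mp hD)
    have hW0 : W = ⊥ := by
      rw [Submodule.eq_bot_iff]
      intro f hf
      funext η b
      have h := hW₂ f hf b
      rw [hD0, Submodule.mem_bot] at h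
      exact congr_fun h η
    simp [hW0]
  | succ n ih =>
    intro D hD W hW₁ hW₂
    by_cases hDn : Module.finrank ℂ D ≤ n
    · exact (ih D hDn W hW₁ hW₂).trans (Nat.mul_le_mul_right m n.le_succ)
    · -- `dim D = n + 1 > 0`: pick `v ∈ D`, `v ≠ 0`, and a coordinate `η₀` with `v η₀ ≠ 0`
      have hDne : D ≠ ⊥ := by
        rintro rfl
        simp at hDn
      obtain ⟨v, hvD, hv0⟩ := Submodule.exists_mem_ne_zero_of_ne_bot hDne
      obtain ⟨η₀, hη₀⟩ : ∃ η₀, v η₀ ≠ 0 := by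
        by_contra h
        push Not at h
        exact hv0 (funext h)
      -- the smaller column space `D' = D ⊓ ker (eval η₀)`
      set D' : Submodule ℂ (E → ℂ) :=
        D ⊓ LinearMap.ker (LinearMap.proj η₀ : (E → ℂ) →ₗ[ℂ] ℂ) with hD'def
      have hD'lt : D' < D := by
        refine lt_of_le_of_ne inf_le_left ?_
        intro h
        have hv' : v ∈ D' := h ▸ hvD
        exact hη₀ (by simpa [hD'def] using hv'.2)
      have hD'n : Module.finrank ℂ D' ≤ n := by
        have := Submodule.finrank_lt_finrank_of_lt hD'lt
        omega
      -- the row map `ρ : W → ℂ^B`, `f ↦ f η₀`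
      let ρ : W →ₗ[ℂ] (B → ℂ) :=
        (LinearMap.proj η₀ : (E → B → ℂ) →ₗ[ℂ] (B → ℂ)).comp W.subtype
      have hrange : Module.finrank ℂ (LinearMap.range ρ) ≤ m := by
        refine (Submodule.finrank_mono ?_).trans (hF η₀)
        rintro _ ⟨f, rfl⟩
        exact hW₁ f f.2 η₀
      have hker : Module.finrank ℂ (LinearMap.ker ρ) ≤ n * m := by
        rw [← Submodule.finrank_map_subtype_eq W (LinearMap.ker ρ)]
        refine ih D' hD'n _ ?_ ?_
        · rintro _ ⟨f, -, rfl⟩ η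
          exact hW₁ f f.2 η
        · rintro _ ⟨f, hf, rfl⟩ b
          refine ⟨hW₂ f f.2 b, ?_⟩
          have h0 : (f : E → B → ℂ) η₀ = 0 := by
            simpa [ρ] using hf
          simp [h0]
      have hrn := LinearMap.finrank_range_add_finrank_ker ρ
      calc Module.finrank ℂ W
          = Module.finrank ℂ (LinearMap.range ρ) + Module.finrank ℂ (LinearMap.ker ρ) := hrn.symm
        _ ≤ m + n * m := add_le_add hrange hker
        _ = (n + 1) * m := by ring

/-- **Component lemma (abstract form).**  Let `D ≤ ℂ^E` and `F η ≤ ℂ^B` (`η ∈ E`) with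
`dim F η ≤ m` for every `η`.  If `W ≤ ℂ^(E × B)` is a subspace of tuples `f = (f η)_η` with every
row `f η ∈ F η` and every column `(f η b)_η ∈ D` (`b ∈ B`), then `dim W ≤ dim D · m`: pointwise
confinement of the isotype vectors to `D` caps the span of the tuples at `dim D` rows' worth. -/
theorem finrank_le_of_pointwise_mem {E B : Type} [Fintype E] [Fintype B] [DecidableEq E]
    [DecidableEq B] (D : Submodule ℂ (E → ℂ)) (F : E → Submodule ℂ (B → ℂ)) (m : ℕ)
    (hF : ∀ η, Module.finrank ℂ (F η) ≤ m) (W : Submodule ℂ (E → B → ℂ))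
    (hW₁ : ∀ f ∈ W, ∀ η, f η ∈ F η) (hW₂ : ∀ f ∈ W, ∀ b, (fun η => f η b) ∈ D) :
    Module.finrank ℂ W ≤ Module.finrank ℂ D * m :=
  finrank_le_mul_of_pointwise_mem_aux F m hF (Module.finrank ℂ D) D le_rfl W hW₁ hW₂

end Summit.MatrixMultiplication.MatrixMultiplication.Theorems.GradedDesignFamily.Negative

end
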